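import Summits.KontsevichZagierPeriods.KontsevichZagierPeriods.Theorems.RootDecompWalshStrataPtypeEngines

/-!
# Root decomposition (Walsh strata), part 46 — P-type fibre discriminants III: placement, frames, atoms

* 46.1 Representations `[U, γ√R]` with the P-type weight exist on bounded semialgebraic `U`.
* 46.2 PLACEMENT (rule (2), constant Jacobian): a bounded open piece anywhere in the plane is moved into
  `[0,1]²` by `w ↦ w/N + ½`; the radicand stays of P-type (`prad_place`), so `InBaker.of_Prad` applies
  (`InBaker.of_Pbdd`); composing with an arbitrary rational affine frame `M` gives `InBaker.of_Paff`.
* 46.3 FRAMES: a planar quadratic polynomial `D` with `disc D = 0` is `R ∘ M` for the P-type radicand `R` and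
  the shear `(x, y) ↦ (x + (d₁₂/2d₁₁)y, y)` (`d₁₁ ≠ 0`) or the swap (`d₁₁ = 0`, forcing `d₁₂ = 0`).
* 46.4 ATOMS: `Quadric₃.sqrtDescentW_Ptype` — the hypothesis `hW` of `quadricBakerDescent_of_sqrtDescentW`
  for every quadric with `disc D = 0`, with NO side condition: the degenerate conic walls (`D ≡ B_ℓ²`
  identically) are exactly the atoms on which `γ√D = ±γ·B_ℓ` is a conic weight (`InBaker.quad_atomFam`);
  all others go through the generic-atom reduction (part 43) and `InBaker.of_Paff`.
* 46.5 The residual form loses `R-P`: `quadricBakerDescent_of_residuals₂ : R-H → R-Eθ → QuadricBakerDescent`.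

References: [KontsevichZagier2001 §1.2 rules (1)–(3)], [BCR1998 §2.2].
-/

noncomputable section

open Set MeasureTheory MvPolynomial Literature.NumberTheory.Transcendental
open Literature.ModelTheory.ExponentialFields (IsSemialgebraic isSemialgebraic_univ isSemialgebraic_empty)

namespace Summit.KontsevichZagierPeriods.RootDecompWalshStrata.ConicDescent.BallCube

/-! #### 46.1 Representations with the P-type weight -/

/-- The P-type weight `γ√R` is `ℚ`-semialgebraic. [BCR1998 §2.2] -/
theorem isSemialgebraicFunOn_pW {s : Set (Fin 2 → ℝ)} (hs : IsSemialgebraic ℚ s) (γ ε e f g : ℚ) :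
    IsSemialgebraicFunOn ℚ s fun w => (γ : ℝ) * √(prad ε e f g w) :=
  ((isSemialgebraicFunOn_ratCast hs γ).mul_holds
    (IsSemialgebraicFunOn.sqrt_holds (isSemialgebraicFunOn_prad ε e f g hs))).congr
    fun w _ => by simp only [Pi.mul_apply]

/-- A bound for the P-type weight on a box. [bookkeeping] -/
theorem abs_pW_le (γ ε e f g : ℚ) {R : ℝ} {w : Fin 2 → ℝ} (hw : ∀ j, |w j| ≤ R) :
    |(γ : ℝ) * √(prad ε e f g w)| ≤
      |(γ : ℝ)| * (1 + (|(ε : ℝ)| * R + |(e : ℝ)| * R ^ 2 + |(f : ℝ)| * R + |(g : ℝ)|)) := by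
  have hR : 0 ≤ R := (abs_nonneg _).trans (hw 0)
  set B : ℝ := |(ε : ℝ)| * R + |(e : ℝ)| * R ^ 2 + |(f : ℝ)| * R + |(g : ℝ)| with hB
  have hB0 : 0 ≤ B := by positivity
  rw [abs_mul, abs_of_nonneg (Real.sqrt_nonneg _)]
  refine mul_le_mul_of_nonneg_left ?_ (abs_nonneg _)
  have h0 : |w 0| ≤ R := hw 0
  have h1 : |w 1| ≤ R := hw 1
  have hp : prad ε e f g w ≤ B := by
    have e1 : (ε : ℝ) * w 1 ≤ |(ε : ℝ)| * R := by
      calc (ε : ℝ) * w 1 ≤ |(ε : ℝ) * w 1| := le_abs_self _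
        _ = |(ε : ℝ)| * |w 1| := abs_mul _ _
        _ ≤ |(ε : ℝ)| * R := mul_le_mul_of_nonneg_left h1 (abs_nonneg _)
    have e2 : (e : ℝ) * w 0 ^ 2 ≤ |(e : ℝ)| * R ^ 2 := by
      calc (e : ℝ) * w 0 ^ 2 ≤ |(e : ℝ) * w 0 ^ 2| := le_abs_self _
        _ = |(e : ℝ)| * w 0 ^ 2 := by rw [abs_mul, abs_of_nonneg (sq_nonneg (w 0))]
        _ ≤ |(e : ℝ)| * R ^ 2 := mul_le_mul_of_nonneg_left
            (sq_le_sq' (abs_le.1 h0).1 (abs_le.1 h0).2) (abs_nonneg _)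
    have e3 : (f : ℝ) * w 0 ≤ |(f : ℝ)| * R := by
      calc (f : ℝ) * w 0 ≤ |(f : ℝ) * w 0| := le_abs_self _
        _ = |(f : ℝ)| * |w 0| := abs_mul _ _
        _ ≤ |(f : ℝ)| * R := mul_le_mul_of_nonneg_left h0 (abs_nonneg _)
    have e4 : (g : ℝ) ≤ |(g : ℝ)| := le_abs_self _
    rw [prad, qD, hB]
    linarith
  calc √(prad ε e f g w) ≤ √((1 + B) ^ 2) := Real.sqrt_le_sqrt (by nlinarith)
    _ = 1 + B := Real.sqrt_sq (by linarith)

/-- **A representation `[U, γ√(ε y + e x² + f x + g)]` exists on every bounded `ℚ`-semialgebraic `U`.**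
[KontsevichZagier2001 §1.1] -/
theorem exists_pRep {U : Set (Fin 2 → ℝ)} (hUs : IsSemialgebraic ℚ U) (hUb : Bornology.IsBounded U)
    (γ ε e f g : ℚ) :
    ∃ τ : KZ.IntegralRep 2, τ.domain = U ∧
      ∀ w ∈ τ.domain, τ.integrand w = (γ : ℝ) * √(prad ε e f g w) := by
  obtain ⟨R, hR⟩ := isBounded_iff_forall_norm_le.1 hUb
  have hw : ∀ w ∈ U, ∀ j, |w j| ≤ R := fun w hw j => by
    rw [← Real.norm_eq_abs]; exact (norm_le_pi_norm w j).trans (hR w hw)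
  exact ⟨bddRep U hUs hUb (fun w => (γ : ℝ) * √(prad ε e f g w)) (isSemialgebraicFunOn_pW hUs γ ε e f g) _
    fun w hw' => abs_pW_le γ ε e f g (hw w hw'), rfl, fun _ _ => rfl⟩

/-! #### 46.2 Placement into the unit square, and arbitrary rational affine frames -/

/-- The PLACEMENT map `w ↦ w/N + ½`. -/
def AffMap.place (N : ℚ) : AffMap := ⟨1 / N, 0, 0, 1 / N, 1 / 2, 1 / 2⟩

/-- Auxiliary step `place_toFun_zero`. [bookkeeping] -/
@[simp] theorem AffMap.place_toFun_zero (N : ℚ) (p : Fin 2 → ℝ) :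
    (AffMap.place N).toFun p 0 = ((1 / N : ℚ) : ℝ) * p 0 + ((1 / 2 : ℚ) : ℝ) := by
  simp [AffMap.place, AffMap.toFun]

/-- Auxiliary step `place_toFun_one`. [bookkeeping] -/
@[simp] theorem AffMap.place_toFun_one (N : ℚ) (p : Fin 2 → ℝ) :
    (AffMap.place N).toFun p 1 = ((1 / N : ℚ) : ℝ) * p 1 + ((1 / 2 : ℚ) : ℝ) := by
  simp [AffMap.place, AffMap.toFun]

/-- Auxiliary step `place_det`. [bookkeeping] -/
theorem AffMap.place_det (N : ℚ) : (AffMap.place N).det = 1 / N ^ 2 := by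
  simp only [AffMap.place, AffMap.det]; ring

/-- The P-type radicand in placed coordinates is again of P-type. [this node] -/
theorem prad_place (ε e f g N : ℚ) (hN : N ≠ 0) (p : Fin 2 → ℝ) :
    prad (ε * N) (e * N ^ 2) (f * N - e * N ^ 2) (g + e * N ^ 2 / 4 - (ε + f) * N / 2)
      ((AffMap.place N).toFun p) = prad ε e f g p := by
  have hN' : (N : ℝ) ≠ 0 := by exact_mod_cast hN
  simp only [prad, qD, AffMap.place_toFun_zero, AffMap.place_toFun_one]
  push_cast
  field_simp
  ring

/-- A bounded planar set is placed inside the unit square by `w ↦ w/N + ½` for `N` large. [folklore] -/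
theorem exists_place_subset_Icc {U : Set (Fin 2 → ℝ)} (hUb : Bornology.IsBounded U) :
    ∃ N : ℕ, 0 < N ∧ (AffMap.place N).toFun '' U ⊆ Icc 0 1 := by
  obtain ⟨R, hR⟩ := isBounded_iff_forall_norm_le.1 hUb
  obtain ⟨N, hN⟩ := exists_nat_ge (2 * max R 0 + 1)
  have hR0 : 0 ≤ max R 0 := le_max_right _ _
  have hN0 : (0 : ℝ) < N := by linarith
  refine ⟨N, by exact_mod_cast hN0, ?_⟩
  rintro _ ⟨w, hw, rfl⟩
  have hwj : ∀ j, -((N : ℝ) / 2) ≤ w j ∧ w j ≤ (N : ℝ) / 2 := fun j => by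
    have h1 : |w j| ≤ max R 0 := by
      rw [← Real.norm_eq_abs]; exact ((norm_le_pi_norm w j).trans (hR w hw)).trans (le_max_left _ _)
    have h2 := abs_le.1 h1
    constructor <;> linarith [h2.1, h2.2]
  have key : ∀ j, 0 ≤ ((1 / (N : ℚ) : ℚ) : ℝ) * w j + ((1 / 2 : ℚ) : ℝ) ∧
      ((1 / (N : ℚ) : ℚ) : ℝ) * w j + ((1 / 2 : ℚ) : ℝ) ≤ 1 := fun j => by
    have k1 : ((1 / (N : ℚ) : ℚ) : ℝ) * w j + ((1 / 2 : ℚ) : ℝ) = (w j + N / 2) / N := by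
      push_cast
      field_simp
    rw [k1, div_le_one hN0]
    exact ⟨div_nonneg (by linarith [(hwj j).1]) hN0.le, by linarith [(hwj j).2]⟩
  have hco : ∀ j, 0 ≤ (AffMap.place (N : ℚ)).toFun w j ∧ (AffMap.place (N : ℚ)).toFun w j ≤ 1 :=
    Fin.forall_fin_two.2 ⟨by rw [AffMap.place_toFun_zero]; exact key 0,
      by rw [AffMap.place_toFun_one]; exact key 1⟩
  exact ⟨fun j => (hco j).1, fun j => (hco j).2⟩

/-- **P-TYPE PIECES ANYWHERE (placement, rule (2)).**  A bounded open piece `U` with `R = ε y + e x² + f x + g > 0`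
on `U` and frontier on the wall locus of `R`, lines `ℓ`, conic walls `q` (non-degenerate when `ε = 0`):
`[U, γ√R] ∈ InBaker`. [KontsevichZagier2001 §1.2 rules (1)–(3); this node] -/
theorem InBaker.of_Pbdd (γ ε e f g : ℚ) {n m : ℕ} (ℓ : Fin n → Wall) (q : Fin m → Wall)
    (hq : ε ≠ 0 ∨ ∀ j, ∃ w : Fin 2 → ℝ, prad ε e f g w ≠ ((q j).eval (w 0) (w 1)) ^ 2)
    (σ : KZ.IntegralRep 2) (hσo : IsOpen σ.domain) (hσb : Bornology.IsBounded σ.domain)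
    (hD : ∀ w ∈ σ.domain, 0 < prad ε e f g w)
    (hσi : ∀ w ∈ σ.domain, σ.integrand w = (γ : ℝ) * √(prad ε e f g w))
    (hfr : ∀ w ∈ closure σ.domain, w ∉ σ.domain → w ∈ wallLocus (prad ε e f g) ℓ q) :
    InBaker (KZ.of σ) := by
  obtain ⟨N, hN, hI⟩ := exists_place_subset_Icc hσb
  have hNq : (N : ℚ) ≠ 0 := by exact_mod_cast hN.ne'
  have hdet : (AffMap.place (N : ℚ)).det ≠ 0 := by
    rw [AffMap.place_det]; exact one_div_ne_zero (pow_ne_zero 2 hNq)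
  have hRp : ∀ p : Fin 2 → ℝ, prad (ε * N) (e * N ^ 2) (f * N - e * N ^ 2)
      (g + e * N ^ 2 / 4 - (ε + f) * N / 2) ((AffMap.place (N : ℚ)).toFun p) = prad ε e f g p :=
    fun p => prad_place ε e f g N hNq p
  obtain ⟨τ, hτd, hτi⟩ := exists_pRep ((AffMap.place (N : ℚ)).isSemialgebraic_image σ.isSemialgebraic_domain)
    ((AffMap.place (N : ℚ)).isBounded_image hσb)
    (γ * N ^ 2) (ε * N) (e * N ^ 2) (f * N - e * N ^ 2) (g + e * N ^ 2 / 4 - (ε + f) * N / 2)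
  refine (AffMap.place (N : ℚ)).inBaker_to hdet σ τ hτd (fun p hp => ?_) ?_
  · rw [hτi _ (by rw [hτd]; exact mem_image_of_mem _ hp), hRp, hσi p hp, AffMap.place_det]
    have hN' : (N : ℝ) ≠ 0 := by exact_mod_cast hN.ne'
    push_cast
    rw [abs_of_pos (by positivity)]
    field_simp
  refine InBaker.of_Prad (γ * N ^ 2) (ε * N) (e * N ^ 2) (f * N - e * N ^ 2)
    (g + e * N ^ 2 / 4 - (ε + f) * N / 2)
    (fun i => (ℓ i).precomp (AffMap.place (N : ℚ)).inv) (fun j => (q j).precomp (AffMap.place (N : ℚ)).inv)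
    ?_ τ (by rw [hτd]; exact (AffMap.place (N : ℚ)).isOpen_image hdet hσo) (by rw [hτd]; exact hI)
    ?_ hτi ?_
  · rcases hq with hε | hq
    · exact Or.inl (mul_ne_zero hε hNq)
    · refine Or.inr fun j => ?_
      obtain ⟨w, hw⟩ := hq j
      refine ⟨(AffMap.place (N : ℚ)).toFun w, ?_⟩
      rw [hRp, Wall.precomp_eval, (AffMap.place (N : ℚ)).inv_toFun hdet]
      exact hw
  · rw [hτd]
    rintro _ ⟨p, hp, rfl⟩
    rw [hRp]
    exact hD p hp
  · rw [hτd]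
    exact wallLocus_transport (AffMap.place (N : ℚ)) hdet hRp
      (fun i p => by rw [Wall.precomp_eval, (AffMap.place (N : ℚ)).inv_toFun hdet])
      (fun i hg => Wall.precomp_gen _ ((AffMap.place (N : ℚ)).inv_det_ne hdet) hg)
      (fun j p => by rw [Wall.precomp_eval, (AffMap.place (N : ℚ)).inv_toFun hdet]) hfr

/-- **P-TYPE PIECES IN A RATIONAL AFFINE FRAME (rule (2)).**  If the radicand is `R ∘ M` for the P-type `R` and a
rational affine `M` with `det M ≠ 0`, a bounded open piece with `R ∘ M > 0` and frontier on the wall locus of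
`R ∘ M` (lines `ℓ`, conic walls `q`, non-degenerate when `ε = 0`) carries `[U, γ√(R ∘ M)] ∈ InBaker`.
[KontsevichZagier2001 §1.2 rules (1)–(3); this node] -/
theorem InBaker.of_Paff (M : AffMap) (hdet : M.det ≠ 0) (γ ε e f g : ℚ) {n m : ℕ} (ℓ : Fin n → Wall)
    (q : Fin m → Wall)
    (hq : ε ≠ 0 ∨ ∀ j, ∃ p : Fin 2 → ℝ, prad ε e f g (M.toFun p) ≠ ((q j).eval (p 0) (p 1)) ^ 2)
    (σ : KZ.IntegralRep 2) (hσo : IsOpen σ.domain) (hσb : Bornology.IsBounded σ.domain)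
    (hD : ∀ p ∈ σ.domain, 0 < prad ε e f g (M.toFun p))
    (hσi : ∀ p ∈ σ.domain, σ.integrand p = (γ : ℝ) * √(prad ε e f g (M.toFun p)))
    (hfr : ∀ p ∈ closure σ.domain, p ∉ σ.domain →
      p ∈ wallLocus (fun p => prad ε e f g (M.toFun p)) ℓ q) :
    InBaker (KZ.of σ) := by
  obtain ⟨τ, hτd, hτi⟩ := exists_pRep (M.isSemialgebraic_image σ.isSemialgebraic_domain)
    (M.isBounded_image hσb) (γ / |M.det|) ε e f g
  refine M.inBaker_to hdet σ τ hτd (fun p hp => ?_) ?_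
  · rw [hτi _ (by rw [hτd]; exact mem_image_of_mem _ hp), hσi p hp]
    have hd : (M.det : ℝ) ≠ 0 := by exact_mod_cast hdet
    have ha : |(M.det : ℝ)| ≠ 0 := abs_ne_zero.2 hd
    push_cast
    field_simp
  refine InBaker.of_Pbdd (γ / |M.det|) ε e f g (fun i => (ℓ i).precomp M.inv) (fun j => (q j).precomp M.inv)
    ?_ τ (by rw [hτd]; exact M.isOpen_image hdet hσo) (by rw [hτd]; exact M.isBounded_image hσb) ?_ hτi ?_
  · rcases hq with hε | hq
    · exact Or.inl hε
    · refine Or.inr fun j => ?_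
      obtain ⟨p, hp⟩ := hq j
      exact ⟨M.toFun p, by rw [Wall.precomp_eval, M.inv_toFun hdet]; exact hp⟩
  · rw [hτd]
    rintro _ ⟨p, hp, rfl⟩
    exact hD p hp
  · rw [hτd]
    exact wallLocus_transport M hdet (fun p => rfl)
      (fun i p => by rw [Wall.precomp_eval, M.inv_toFun hdet])
      (fun i hg => Wall.precomp_gen _ (M.inv_det_ne hdet) hg)
      (fun j p => by rw [Wall.precomp_eval, M.inv_toFun hdet]) hfr

/-! #### 46.3 Frames of a rank `≤ 1` planar quadratic -/

namespace Quad2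

variable (D : Quad2)

/-- The P-SHEAR `(x, y) ↦ (x + (d₁₂/2d₁₁) y, y)` (for `d₁₁ ≠ 0`). -/
def pshear : AffMap := ⟨1, D.d12 / (2 * D.d11), 0, 1, 0, 0⟩

/-- `ε` of the P-type normal form (for `d₁₁ ≠ 0`): the `y`-coefficient after the shear. -/
def pε : ℚ := D.d2 - D.d1 * D.d12 / (2 * D.d11)

/-- Auxiliary step `pshear_det`. [bookkeeping] -/
theorem pshear_det : D.pshear.det = 1 := by
  simp only [pshear, AffMap.det]; ring

/-- **P-FRAME, `d₁₁ ≠ 0`.**  `D = R ∘ (shear)` with `R = pε·Y + d₁₁X² + d₁X + d₀` when `disc D = 0`. [this node] -/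
theorem eval_eq_prad_shear (h11 : D.d11 ≠ 0) (hdisc : D.disc = 0) (p : Fin 2 → ℝ) :
    D.eval (p 0) (p 1) = prad D.pε D.d11 D.d1 D.d0 (D.pshear.toFun p) := by
  have h11' : (D.d11 : ℝ) ≠ 0 := by exact_mod_cast h11
  have hd : (D.d22 : ℝ) * (4 * D.d11) = D.d12 ^ 2 := by
    have h : (4 * D.d11 * D.d22 - D.d12 ^ 2 : ℚ) = 0 := hdisc
    have h' : ((4 * D.d11 * D.d22 - D.d12 ^ 2 : ℚ) : ℝ) = 0 := by rw [h, Rat.cast_zero]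
    push_cast at h'
    linarith
  simp only [eval, prad, qD, pε, pshear, AffMap.toFun_zero, AffMap.toFun_one]
  push_cast
  field_simp
  linear_combination (p 1) ^ 2 * hd

/-- **P-FRAME, `d₁₁ = 0`.**  Then `d₁₂ = 0` and `D = R ∘ swap` with `R = d₁·Y + d₂₂X² + d₂X + d₀`. [this node] -/
theorem eval_eq_prad_swap (h11 : D.d11 = 0) (hdisc : D.disc = 0) (p : Fin 2 → ℝ) :
    D.eval (p 0) (p 1) = prad D.d1 D.d22 D.d2 D.d0 (AffMap.swap.toFun p) := by
  have h12 : D.d12 = 0 := by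
    have h : 4 * D.d11 * D.d22 - D.d12 ^ 2 = 0 := hdisc
    rw [h11, mul_zero, zero_mul, zero_sub, neg_eq_zero] at h
    exact (pow_eq_zero_iff two_ne_zero).1 h
  simp only [eval, prad, qD, AffMap.swap_toFun_zero, AffMap.swap_toFun_one, h11, h12]
  push_cast
  ring

end Quad2

/-! #### 46.4 The wall-family atoms of a P-type quadric -/

namespace Quadric₃

variable (K : Quadric₃)

/-- A quadric whose fibre discriminant is the square of a rational-affine form `L` with a definite sign on the
atom: `γ√D = ±γ·L` is a conic weight, so `[atom, γ√D] ∈ InBaker` by quadratic descent. [this node] -/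
theorem inBaker_watom_of_sq (ℓ₁ ℓ₂ g : Wall) (γ : ℚ) (σ : Fin 6 → SignType) (L : Wall)
    (hL : ∀ v : Fin 2 → ℝ, K.Dxy (v 0) (v 1) = (L.eval (v 0) (v 1)) ^ 2) (s : ℚ) (hs : s = 1 ∨ s = -1)
    (hsg : ∀ v ∈ atomFam (K.wfam ℓ₁ ℓ₂ g) σ, 0 ≤ (s : ℝ) * L.eval (v 0) (v 1))
    (r : KZ.IntegralRep 2) (hrd : r.domain = atomFam (K.wfam ℓ₁ ℓ₂ g) σ)
    (hri : EqOn r.integrand (fun v => (γ : ℝ) * √(K.Dxy (v 0) (v 1))) r.domain) : InBaker (KZ.of r) :=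
  InBaker.quad_atomFam _ σ ⟨0, s * γ * L.k2, 0, s * γ * L.k0, s * γ * L.k1, 0⟩ r hrd fun v hv => by
    rw [hri hv]
    show (γ : ℝ) * √(K.Dxy (v 0) (v 1)) = _
    rw [sqrt_eq_of_wall hs (hL v) (hsg v (by rw [← hrd]; exact hv))]
    simp only [Conic.pxy, Conic.Bx, Conic.Cx, Wall.eval]
    push_cast
    ring

/-- The `B`-wall of `ℓ` evaluates to the conic `3` of the shifted quadric. [bookkeeping] -/
theorem bwall_eval_eq_conic (ℓ : Wall) (v : Fin 2 → ℝ) :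
    (K.bwall ℓ).eval (v 0) (v 1) = ((K.shiftW ℓ).conic 3).pxy (v 0) (v 1) := by
  rw [K.bwall_eval, show (K.shiftW ℓ).Bxy (v 0) (v 1) = (K.shiftW ℓ).adapted 3 v from rfl,
    (K.shiftW ℓ).adapted_eq_conic]

/-- **`hW` IN A P-FRAME.**  If `D = R ∘ M` for a P-type radicand `R` and a rational affine frame `M`, then
`[atom, γ√D] ∈ InBaker` for every atom of the wall family and every sign vector, with no side condition.
[KontsevichZagier2001 §1.2; this node] -/
theorem sqrtDescentW_Pframe (M : AffMap) (hdet : M.det ≠ 0) (ε e f g₀ : ℚ)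
    (hframe : ∀ p : Fin 2 → ℝ, K.dq.eval (p 0) (p 1) = prad ε e f g₀ (M.toFun p))
    (ℓ₁ ℓ₂ g : Wall) (γ : ℚ) (σ : Fin 6 → SignType)
    (r : KZ.IntegralRep 2) (hrd : r.domain = atomFam (K.wfam ℓ₁ ℓ₂ g) σ)
    (hri : EqOn r.integrand (fun v => (γ : ℝ) * √(K.Dxy (v 0) (v 1))) r.domain) :
    InBaker (KZ.of r) := by
  classical
  refine K.sqrtDescentW_generic ℓ₁ ℓ₂ g γ σ r hrd hri fun ho hb hD hi hfr hnull hne => ?_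
  have hsgn : ∀ s : SignType, s = 0 ∨ s = -1 ∨ s = 1 := fun s => by cases s <;> simp
  obtain ⟨v₀, hv₀⟩ := hne
  have hv₀' : v₀ ∈ atomFam (K.wfam ℓ₁ ℓ₂ g) σ := by rw [← hrd]; exact hv₀
  have hD₀ : 0 < K.Dxy (v₀ 0) (v₀ 1) := by rw [K.Dxy_eq_dq]; exact hD v₀ hv₀
  -- the degenerate conic walls: `D ≡ B_ℓ²` with `B_ℓ` of definite sign on the atom
  have hdeg : ∀ (ℓ : Wall) (i : Fin 6), K.wfam ℓ₁ ℓ₂ g i = (K.shiftW ℓ).conic 3 →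
      (∀ v : Fin 2 → ℝ, K.Dxy (v 0) (v 1) = ((K.bwall ℓ).eval (v 0) (v 1)) ^ 2) → InBaker (KZ.of r) := by
    intro ℓ i hi hL
    have hsign : ∀ v ∈ atomFam (K.wfam ℓ₁ ℓ₂ g) σ,
        SignType.sign ((K.bwall ℓ).eval (v 0) (v 1)) = σ i := fun v hv => by
      rw [K.bwall_eval_eq_conic, ← hi]; exact hv.2 i
    rcases hsgn (σ i) with h0 | hm | hp
    · exfalso
      have hB : (K.bwall ℓ).eval (v₀ 0) (v₀ 1) = 0 := by
        rw [K.bwall_eval_eq_conic, ← hi]; exact hnull i h0 v₀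
      have h := hL v₀
      rw [hB] at h
      linarith [hD₀]
    · exact K.inBaker_watom_of_sq ℓ₁ ℓ₂ g γ σ (K.bwall ℓ) hL (-1) (Or.inr rfl) (fun v hv => by
        have hlt := sign_eq_neg_one_iff.1 ((hsign v hv).trans hm)
        push_cast; linarith) r hrd hri
    · exact K.inBaker_watom_of_sq ℓ₁ ℓ₂ g γ σ (K.bwall ℓ) hL 1 (Or.inl rfl) (fun v hv => by
        have hlt := sign_eq_one_iff.1 ((hsign v hv).trans hp)
        push_cast; linarith) r hrd hri
  by_cases hsq : ∃ j : Fin 2, ∀ v : Fin 2 → ℝ,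
      K.Dxy (v 0) (v 1) = ((![K.bwall ℓ₁, K.bwall ℓ₂] j).eval (v 0) (v 1)) ^ 2
  · obtain ⟨j, hj⟩ := hsq
    have hj2 : j = 0 ∨ j = 1 := by fin_cases j <;> simp
    rcases hj2 with rfl | rfl
    · exact hdeg ℓ₁ 2 rfl (by simpa using hj)
    · exact hdeg ℓ₂ 4 rfl (by simpa using hj)
  -- the generic P-type atom
  have hq : ε ≠ 0 ∨ ∀ j, ∃ p : Fin 2 → ℝ,
      prad ε e f g₀ (M.toFun p) ≠ ((![K.bwall ℓ₁, K.bwall ℓ₂] j).eval (p 0) (p 1)) ^ 2 := by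
    refine Or.inr fun j => ?_
    by_contra hcon
    simp only [not_exists, ne_eq, not_not] at hcon
    exact hsq ⟨j, fun v => by rw [K.Dxy_eq_dq, hframe]; exact hcon v⟩
  have hRe : (fun p : Fin 2 → ℝ => K.dq.eval (p 0) (p 1)) = fun p => prad ε e f g₀ (M.toFun p) :=
    funext hframe
  rw [hRe] at hfr
  refine InBaker.of_Paff M hdet γ ε e f g₀ _ _ hq r ho hb (fun p hp => ?_) (fun p hp => ?_) hfr
  · rw [← hframe]; exact hD p hp
  · rw [hi p hp, hframe]

/-- **`hW` ON P-TYPE QUADRICS (the residual `R-P`, closed).**  For a quadric `K` whose fibre discriminant has a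
quadratic part of vanishing discriminant, `[atom, γ√D] ∈ InBaker` for every atom of the wall family `K.wfam ℓ₁ ℓ₂ g`
and every sign vector — no side condition. [KontsevichZagier2001 §1.2; this node] -/
theorem sqrtDescentW_Ptype (hP : K.dq.disc = 0) (ℓ₁ ℓ₂ g : Wall) (γ : ℚ) (σ : Fin 6 → SignType)
    (r : KZ.IntegralRep 2) (hrd : r.domain = atomFam (K.wfam ℓ₁ ℓ₂ g) σ)
    (hri : EqOn r.integrand (fun v => (γ : ℝ) * √(K.Dxy (v 0) (v 1))) r.domain) :
    InBaker (KZ.of r) := by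
  by_cases h11 : K.dq.d11 = 0
  · exact K.sqrtDescentW_Pframe AffMap.swap (by rw [AffMap.swap_det]; norm_num) _ _ _ _
      (K.dq.eval_eq_prad_swap h11 hP) ℓ₁ ℓ₂ g γ σ r hrd hri
  · exact K.sqrtDescentW_Pframe K.dq.pshear (by rw [K.dq.pshear_det]; exact one_ne_zero) _ _ _ _
      (K.dq.eval_eq_prad_shear h11 hP) ℓ₁ ℓ₂ g γ σ r hrd hri

end Quadric₃

/-! #### 46.5 The residual form without `R-P` -/

/-- **THE RESIDUAL OF `hW`, II.**  `hW` follows from its instances on the indefinite stratum (R-H) and on the thin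
E-type strata (R-Eθ); the rank `≤ 1` stratum is `Quadric₃.sqrtDescentW_Ptype`. [this node] -/
theorem sqrtDescentW_of_residuals₂
    (hH : ∀ (L : Quadric₃) (ℓ₁ ℓ₂ g : Wall) (γ : ℚ) (σ : Fin 6 → SignType) (r : KZ.IntegralRep 2),
      L.dq.disc < 0 → r.domain = atomFam (L.wfam ℓ₁ ℓ₂ g) σ →
      EqOn r.integrand (fun v => (γ : ℝ) * √(L.Dxy (v 0) (v 1))) r.domain → InBaker (KZ.of r))
    (hθ : ∀ (L : Quadric₃) (ℓ₁ ℓ₂ g : Wall) (γ : ℚ) (σ : Fin 6 → SignType) (r : KZ.IntegralRep 2),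
      0 < L.dq.disc →
      ¬((L.bwall ℓ₁).precomp L.dq.lagM.inv ∈ goodWalls 1 L.dq.eκ L.dq.d11 L.dq.cst ∧
          (L.bwall ℓ₂).precomp L.dq.lagM.inv ∈ goodWalls 1 L.dq.eκ L.dq.d11 L.dq.cst) →
      r.domain = atomFam (L.wfam ℓ₁ ℓ₂ g) σ →
      EqOn r.integrand (fun v => (γ : ℝ) * √(L.Dxy (v 0) (v 1))) r.domain → InBaker (KZ.of r)) :
    ∀ (L : Quadric₃) (ℓ₁ ℓ₂ g : Wall) (γ : ℚ) (σ : Fin 6 → SignType) (r : KZ.IntegralRep 2),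
      r.domain = atomFam (L.wfam ℓ₁ ℓ₂ g) σ →
      EqOn r.integrand (fun v => (γ : ℝ) * √(L.Dxy (v 0) (v 1))) r.domain → InBaker (KZ.of r) :=
  sqrtDescentW_of_residuals hH (fun L ℓ₁ ℓ₂ g γ σ r hP hrd hri => L.sqrtDescentW_Ptype hP ℓ₁ ℓ₂ g γ σ r hrd hri) hθ

/-- **`QuadricBakerDescent` FROM TWO RESIDUALS** (stmt-KontsevichZagierPeriods-27597 ⟸ R-H ∧ R-Eθ). [this node] -/
theorem quadricBakerDescent_of_residuals₂
    (hH : ∀ (L : Quadric₃) (ℓ₁ ℓ₂ g : Wall) (γ : ℚ) (σ : Fin 6 → SignType) (r : KZ.IntegralRep 2),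
      L.dq.disc < 0 → r.domain = atomFam (L.wfam ℓ₁ ℓ₂ g) σ →
      EqOn r.integrand (fun v => (γ : ℝ) * √(L.Dxy (v 0) (v 1))) r.domain → InBaker (KZ.of r))
    (hθ : ∀ (L : Quadric₃) (ℓ₁ ℓ₂ g : Wall) (γ : ℚ) (σ : Fin 6 → SignType) (r : KZ.IntegralRep 2),
      0 < L.dq.disc →
      ¬((L.bwall ℓ₁).precomp L.dq.lagM.inv ∈ goodWalls 1 L.dq.eκ L.dq.d11 L.dq.cst ∧
          (L.bwall ℓ₂).precomp L.dq.lagM.inv ∈ goodWalls 1 L.dq.eκ L.dq.d11 L.dq.cst) →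
      r.domain = atomFam (L.wfam ℓ₁ ℓ₂ g) σ →
      EqOn r.integrand (fun v => (γ : ℝ) * √(L.Dxy (v 0) (v 1))) r.domain → InBaker (KZ.of r)) :
    Summit.KontsevichZagierPeriods.KontsevichZagierPeriods.Theses.RootDecompWalshStrata.QuadricBakerDescent :=
  quadricBakerDescent_of_sqrtDescentW (sqrtDescentW_of_residuals₂ hH hθ)

end Summit.KontsevichZagierPeriods.RootDecompWalshStrata.ConicDescent.BallCube

end
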